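import Literature.MathematicalPhysics.QuantumLattice.TIDensityPhaseCoexistence
import Literature.MathematicalPhysics.QuantumLattice.SingleDirectionHoppingKinematicRow
import Literature.MathematicalPhysics.QuantumLattice.LayeredVerticalStackingThermal
import Literature.MathematicalPhysics.QuantumLattice.HubbardTTPrimeThermalPhaseCoexistenceHotAnchor
import Mathlib.Analysis.Real.Pi.Bounds
import HarnessLib

/-!
# The INTERLAYER (c-axis) AXIS of the competing-orders word: certified exclusion of macroscopic phase separation in the 3D
# LAYERED `t–t'` Hubbard crystal, at `T = 0` and `T > 0`, from the 2D windows — margin `M ↦ M − (4/π)·Σ_b |t_{z,b}|`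

Topic `Literature/MathematicalPhysics/QuantumLattice` (family `hubbard`; D-0096 (iii) «model order → real material: INTERLAYER COUPLING ×
COMPETING ORDERS»). The layered crystal on `ℤ³` is the tree's `layeredHubbardTTPrime t t' U w tz` (in every layer the `t–t'–U` model, plus
interlayer hoppings `tz_b` along vectors `w_b` with `(w_b)₀ ≠ 0`, `LayeredLatticeEnergyTransport`; simple tetragonal stacking:
`verticalHubbardTTPrime t t' U t_z`). Its fixed-filling numbers sit in 2D windows whose width is the one-direction kinematic bound
`κ := (4/π)·Σ_b|tz_b|` (DENSITY-INDEPENDENT):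

* `T = 0`: `E₃(ρ) := (layeredHubbardTTPrime …).tiGroundEnergyDensityAt R' ρ ∈ [e(ρ) − κ, e(ρ)]`
  (`tiGroundEnergyDensityAt_layeredHubbardTTPrime_mem_Icc_sharp`, `e = energyDensityTT'`);
* `T > 0`: `P₃(β;ρ) := (layeredHubbardTTPrime …).varPressureAt β R' ρ ∈ [p(β;ρ), p(β;ρ) + βκ]`
  (`varPressureAt_layeredHubbardTTPrime_mem_Icc_pressureTT'`, `p = pressureTT'`).

Feeding them into the model-free laws of `TIDensityPhaseCoexistence` (`d = 3`) — exactly as the Zeeman field is handled in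
`HubbardTTPrimePhaseCoexistenceExclusionZeeman` (the interlayer hopping and the field are both linear perturbations with an a-priori window) —
gives, PROVED (`U ≥ 0`, interlayer vectors inside the range box `R' ≥ 1`):

* §0 (private) the rational bound `4/π < 200/157` (`Real.pi_gt_d2`) and `(4/π)·x ≤ (200/157)·τ₀` for `0 ≤ x ≤ τ₀` — how the vertical corollaries turn «`|t_z| ≤ τ₀`»
  into a rational cost;
* §1 `T = 0` (`layeredGroundEnergy_lt_meanEnergy_mix_of_cap_lt_floors_of_le`): a 2D CAP `e(an₁ + bn₂) ≤ c` and 2D FLOORS `f_i ≤ e(n_i)` with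
  `c + κ < a f₁ + b f₂` exclude every macroscopic mixture of translation-invariant states ON `ℤ³` with densities `ρ(ω₁) ≤ n₁ < n₂ ≤ ρ(ω₂)` from
  being a ground state of the layered crystal at any mean density; cost form `(hk : κ ≤ k)`, `c + k < a f₁ + b f₂`; vertical corollary;
* §2 `T > 0` (`sub_mul_layered_lt_varPressureAt_mix_of_hotAnchors_of_le`): the HOT-ANCHORED energy-window law (2D cap, 2D floors, 2D pressure
  ceilings `p(β_{h,i}; n_i) ≤ π_i` at hotter `β_{h,i} ≤ β`) excludes the coexistence in every canonical equilibrium state of the layered crystal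
  at `β` as soon as `aπ₁ + bπ₂ + β_{h,1}af₁ + β_{h,2}bf₂ < β·(af₁ + bf₂ − c − κ)`; threshold form «for every `β ≥ β₀`, every stacking with
  `κ ≤ k`»; vertical corollary;
* §3 `t_z = 0`: `P₃ = p` (`varPressureAt_layeredHubbardTTPrime_zero`, recalled in threshold shape).

READING (how instances print it): «the 2D competing-orders word of margin `M` is a word of the 3D layered crystal for every stacking with
`Σ_b|t_{z,b}| < (π/4)·M`» — at the registry point `(8,·,0)` (`M = 0.0503`) up to `Σ|tz| ≈ t/25` (`≈ 14 meV` at `t = 0.35 eV` [float]); the cost is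
the CRUDE linear kinematic one (the true interlayer energy is `O(t_z²/t)`), so this is a floor on the reach, not an estimate of it.
HONEST SCOPE: exclusion of MACROSCOPIC coexistence (mixtures of translation-invariant states on `ℤ³`); the `T > 0` statement is about canonical
equilibrium states of the layered crystal in the variational sense; interlayer hoppings enter only through `Σ_b|tz_b|` (any stacking vectors);
inputs are 2D claim nodes / kernel rows of the instance files; nothing about stripes, which phase is realised, superconductivity or `T_c`.
Everything is PROVED; no definition, no named fact, no number. Written 2026-08-28 by hubbard-downfold-unc-2 (g21; cell `pub/hubbard-downfold`,
MO-S1 ↔ S2 seam, filling direction).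

## Mathlib / tree search
REUSED: `IsTranslationInvariant.tiGroundEnergyDensityAt_lt_meanEnergy_mix_of_cap_lt_floors_of_le`,
`IsTranslationInvariant.sub_mul_lt_varPressureAt_mix_of_caps_lt_floor_of_le` (`TIDensityPhaseCoexistence`);
`tiGroundEnergyDensityAt_layeredHubbardTTPrime_mem_Icc_sharp` (`SingleDirectionHoppingKinematicRow`); `varPressureAt_layeredHubbardTTPrime_mem_Icc_pressureTT'`,
`varPressureAt_layeredHubbardTTPrime_zero` (`CanonicalVariationalPressure`); `verticalHubbardTTPrime` (`LayeredVerticalStackingThermal`);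
`unitVec_zero_apply_zero_ne_zero`, `unitVec_mem_thicken_one` (`LayeredLatticeEnergyTransport`); `pressureTT'_mem_Icc`,
`pressureTT'_le_hotCeiling_sub_mul_of_floor`; Mathlib `Real.pi_gt_d2`. `lean search 'layered.*mix|coexist.*layer'` (2026-08-28): nothing.

## References
* R. B. Israel, *Convexity in the Theory of Lattice Gases* (1979), Thm. I.2.4, Thm. I.3.4. [cite: Israel1979, Thm. I.2.4]
* O. Bratteli, A. Kishimoto, D. W. Robinson, Commun. Math. Phys. 64 (1978) 41, Thm. 2. [cite: BratteliKishimotoRobinson1978, Thm. 2 (condition 2)]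
* E. Pavarini, I. Dasgupta, T. Saha-Dasgupta, O. Jepsen, O. K. Andersen, Phys. Rev. Lett. 87 (2001) 047003, eq. (1). [cite: PavariniEtAl2001, eq. (1)]
* V. J. Emery, S. A. Kivelson, H. Q. Lin, Phys. Rev. Lett. 64 (1990) 475. [cite: EmeryKivelsonLin1990, pp. 475–476]
* D. Ruelle, *Statistical Mechanics: Rigorous Results* (1969), §3.4. [cite: Ruelle1969, §3.4]
-/

noncomputable section

open scoped ComplexOrder BigOperators
open Filter Topology Set

namespace Literature.MathematicalPhysics.QuantumLattice

open Matrix HubbardWave0 Literature.Probability.LatticeModels ThermodynamicLimit InfVolFermionState FermionInteraction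

/-! ### §0 The rational interlayer cost -/

/-- `4/π < 200/157` (`π > 3.14`). [folklore] -/
private theorem four_div_pi_lt : 4 / Real.pi < 200 / 157 := by
  have hπ := Real.pi_gt_d2
  rw [div_lt_div_iff₀ Real.pi_pos (by norm_num)]
  nlinarith

/-- `(4/π)·x ≤ (200/157)·τ₀` for `0 ≤ x ≤ τ₀` — how instances bound the interlayer cost `(4/π)·Σ_b|tz_b|` by a rational when
`Σ_b|tz_b| ≤ τ₀`. [folklore] -/
private theorem four_div_pi_mul_le_of_le {x τ₀ : ℝ} (hx : 0 ≤ x) (hτ : x ≤ τ₀) : 4 / Real.pi * x ≤ 200 / 157 * τ₀ := by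
  have h1 : 4 / Real.pi * x ≤ 200 / 157 * x := mul_le_mul_of_nonneg_right four_div_pi_lt.le hx
  have h2 : (200 : ℝ) / 157 * x ≤ 200 / 157 * τ₀ := mul_le_mul_of_nonneg_left hτ (by norm_num)
  exact h1.trans h2

/-- Weights: `a n₁ + b n₂ ∈ [n₁, n₂]` for `a, b ≥ 0`, `a + b = 1`, `n₁ ≤ n₂`. [folklore] -/
private theorem convexComb_mem_Icc' {a b n₁ n₂ : ℝ} (ha : 0 ≤ a) (hb : 0 ≤ b) (hab : a + b = 1) (h : n₁ ≤ n₂) :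
    n₁ ≤ a * n₁ + b * n₂ ∧ a * n₁ + b * n₂ ≤ n₂ := by
  have e1 : a * n₁ + b * n₂ = n₁ + b * (n₂ - n₁) := by
    have ha' : a = 1 - b := by linarith
    rw [ha']; ring
  have e2 : a * n₁ + b * n₂ = n₂ - a * (n₂ - n₁) := by
    have hb' : b = 1 - a := by linarith
    rw [hb']; ring
  constructor
  · rw [e1]; nlinarith [mul_nonneg hb (sub_nonneg.2 h)]
  · rw [e2]; nlinarith [mul_nonneg ha (sub_nonneg.2 h)]

namespace InfVolFermionState

/-! ### §1 `T = 0`: ground states of the layered crystal -/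

section LayeredGround

variable (t t' : ℝ) {U : ℝ} (hU : 0 ≤ U) {κ : Type*} [Fintype κ] {w : κ → Site 3} (hw : ∀ b, w b 0 ≠ 0) (tz : κ → ℝ)
  {R' : ℝ} (hR' : 1 ≤ R') (hwR' : ∀ b, w b ∈ thicken ({0} : Finset (Site 3)) R') {ω₁ ω₂ : InfVolFermionState 3}
include hU hw hR' hwR'

/-- **`T = 0` competing-orders word of the LAYERED crystal from 2D windows.** `U ≥ 0`; translation-invariant states `ω₁, ω₂` on `ℤ³`
with `0 < ρ(ω₁) ≤ n₁ < n₂ ≤ ρ(ω₂) < 2`; weights `a, b ≥ 0`, `a + b = 1`; a 2D CAP `e(an₁ + bn₂) ≤ c` and 2D FLOORS `f₁ ≤ e(n₁)`,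
`f₂ ≤ e(n₂)` with `c + (4/π)Σ_b|tz_b| < a f₁ + b f₂`. Then for every `0 < λ < 1` the mixture `λω₁ + (1−λ)ω₂` is NOT a ground state of the
layered crystal at its filling: `E₃(ρ(mix)) < e_{Φ₃}(mix)`. (The 2D cap is a 3D cap; the 2D floors drop by `κ = (4/π)Σ|tz|`.)
[cite: Israel1979, Thm. I.2.4] [cite: BratteliKishimotoRobinson1978, Thm. 2 (condition 2)] -/
theorem IsTranslationInvariant.layeredGroundEnergy_lt_meanEnergy_mix_of_cap_lt_floors_of_le (h₁ : ω₁.IsTranslationInvariant)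
    (h₂ : ω₂.IsTranslationInvariant) (hρ₁0 : 0 < ω₁.density) (hρ₂2 : ω₂.density < 2)
    {n₁ n₂ : ℝ} (hn₁ : ω₁.density ≤ n₁) (hn12 : n₁ < n₂) (hn₂ : n₂ ≤ ω₂.density)
    {a b : ℝ} (ha : 0 ≤ a) (hb : 0 ≤ b) (hab : a + b = 1) {c f₁ f₂ : ℝ}
    (hcap : energyDensityTT' t t' U (a * n₁ + b * n₂) ≤ c)
    (hf₁ : f₁ ≤ energyDensityTT' t t' U n₁) (hf₂ : f₂ ≤ energyDensityTT' t t' U n₂)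
    (hM : c + 4 / Real.pi * ∑ b, |tz b| < a * f₁ + b * f₂)
    {lam : ℝ} (hl0 : 0 < lam) (hl1 : lam < 1) :
    (layeredHubbardTTPrime t t' U w tz).tiGroundEnergyDensityAt R' (InfVolFermionState.mix lam hl0.le hl1.le ω₁ ω₂).density <
      (InfVolFermionState.mix lam hl0.le hl1.le ω₁ ω₂).meanEnergy (layeredHubbardTTPrime t t' U w tz) R' := by
  have hn₁0 : 0 < n₁ := lt_of_lt_of_le hρ₁0 hn₁
  have hn₁2 : n₁ < 2 := by linarith
  have hn₂0 : 0 < n₂ := by linarith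
  have hn₂2 : n₂ < 2 := lt_of_le_of_lt hn₂ hρ₂2
  obtain ⟨hmlo, hmhi⟩ := convexComb_mem_Icc' ha hb hab hn12.le
  have hm0 : 0 < a * n₁ + b * n₂ := lt_of_lt_of_le hn₁0 hmlo
  have hm2 : a * n₁ + b * n₂ < 2 := lt_of_le_of_lt hmhi hn₂2
  have hcap' := (tiGroundEnergyDensityAt_layeredHubbardTTPrime_mem_Icc_sharp t t' hU hm0 hm2 hw tz hR' hwR').2.trans hcap
  have hf₁' := (tiGroundEnergyDensityAt_layeredHubbardTTPrime_mem_Icc_sharp t t' hU hn₁0 hn₁2 hw tz hR' hwR').1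
  have hf₂' := (tiGroundEnergyDensityAt_layeredHubbardTTPrime_mem_Icc_sharp t t' hU hn₂0 hn₂2 hw tz hR' hwR').1
  refine h₁.tiGroundEnergyDensityAt_lt_meanEnergy_mix_of_cap_lt_floors_of_le (layeredHubbardTTPrime t t' U w tz) R' h₂ hn₁ hn12
    hn₂ ha hb hab hcap' (f₁ := f₁ - 4 / Real.pi * ∑ b, |tz b|) (f₂ := f₂ - 4 / Real.pi * ∑ b, |tz b|)
    (by linarith) (by linarith) ?_ hl0 hl1
  have e : a * (f₁ - 4 / Real.pi * ∑ b, |tz b|) + b * (f₂ - 4 / Real.pi * ∑ b, |tz b|) =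
      a * f₁ + b * f₂ - (a + b) * (4 / Real.pi * ∑ b, |tz b|) := by ring
  rw [e, hab, one_mul]
  linarith

/-- **Cost form** (how instances state «every stacking with `(4/π)Σ|tz| ≤ k`»): `c + k < a f₁ + b f₂` and `(4/π)Σ_b|tz_b| ≤ k` exclude the
coexistence among ground states of the layered crystal. [cite: Israel1979, Thm. I.2.4] -/
theorem IsTranslationInvariant.layeredGroundEnergy_lt_meanEnergy_mix_of_cap_lt_floors_of_cost_le (h₁ : ω₁.IsTranslationInvariant)
    (h₂ : ω₂.IsTranslationInvariant) (hρ₁0 : 0 < ω₁.density) (hρ₂2 : ω₂.density < 2)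
    {n₁ n₂ : ℝ} (hn₁ : ω₁.density ≤ n₁) (hn12 : n₁ < n₂) (hn₂ : n₂ ≤ ω₂.density)
    {a b : ℝ} (ha : 0 ≤ a) (hb : 0 ≤ b) (hab : a + b = 1) {c f₁ f₂ k : ℝ}
    (hcap : energyDensityTT' t t' U (a * n₁ + b * n₂) ≤ c)
    (hf₁ : f₁ ≤ energyDensityTT' t t' U n₁) (hf₂ : f₂ ≤ energyDensityTT' t t' U n₂)
    (hk : 4 / Real.pi * ∑ b, |tz b| ≤ k) (hM₀ : c + k < a * f₁ + b * f₂)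
    {lam : ℝ} (hl0 : 0 < lam) (hl1 : lam < 1) :
    (layeredHubbardTTPrime t t' U w tz).tiGroundEnergyDensityAt R' (InfVolFermionState.mix lam hl0.le hl1.le ω₁ ω₂).density <
      (InfVolFermionState.mix lam hl0.le hl1.le ω₁ ω₂).meanEnergy (layeredHubbardTTPrime t t' U w tz) R' :=
  h₁.layeredGroundEnergy_lt_meanEnergy_mix_of_cap_lt_floors_of_le t t' hU hw tz hR' hwR' h₂ hρ₁0 hρ₂2 hn₁ hn12 hn₂ ha hb hab
    hcap hf₁ hf₂ (by linarith) hl0 hl1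

end LayeredGround

/-- **Simple tetragonal stacking, `T = 0`**: one vertical hopping `t_z` with `|t_z| ≤ τ₀` and `c + (200/157)·τ₀ < a f₁ + b f₂` (2D cap and
floors): the `(≤ n₁ ∣ ≥ n₂)` coexistence is excluded among ground states of `verticalHubbardTTPrime t t' U t_z`.
[cite: Israel1979, Thm. I.2.4] [cite: PavariniEtAl2001, eq. (1)] -/
theorem IsTranslationInvariant.verticalGroundEnergy_lt_meanEnergy_mix_of_cap_lt_floors_of_abs_le (t t' : ℝ) {U : ℝ} (hU : 0 ≤ U)
    {tz τ₀ : ℝ} (hτ : |tz| ≤ τ₀) {ω₁ ω₂ : InfVolFermionState 3} (h₁ : ω₁.IsTranslationInvariant)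
    (h₂ : ω₂.IsTranslationInvariant) (hρ₁0 : 0 < ω₁.density) (hρ₂2 : ω₂.density < 2)
    {n₁ n₂ : ℝ} (hn₁ : ω₁.density ≤ n₁) (hn12 : n₁ < n₂) (hn₂ : n₂ ≤ ω₂.density)
    {a b : ℝ} (ha : 0 ≤ a) (hb : 0 ≤ b) (hab : a + b = 1) {c f₁ f₂ : ℝ}
    (hcap : energyDensityTT' t t' U (a * n₁ + b * n₂) ≤ c)
    (hf₁ : f₁ ≤ energyDensityTT' t t' U n₁) (hf₂ : f₂ ≤ energyDensityTT' t t' U n₂)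
    (hM₀ : c + 200 / 157 * τ₀ < a * f₁ + b * f₂)
    {lam : ℝ} (hl0 : 0 < lam) (hl1 : lam < 1) :
    (verticalHubbardTTPrime t t' U tz).tiGroundEnergyDensityAt 1 (InfVolFermionState.mix lam hl0.le hl1.le ω₁ ω₂).density <
      (InfVolFermionState.mix lam hl0.le hl1.le ω₁ ω₂).meanEnergy (verticalHubbardTTPrime t t' U tz) 1 := by
  have hk : 4 / Real.pi * ∑ _b : Fin 1, |(fun _ : Fin 1 => tz) _b| ≤ 200 / 157 * τ₀ := by
    simp only [Finset.univ_unique, Fin.default_eq_zero, Finset.sum_singleton]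
    exact four_div_pi_mul_le_of_le (abs_nonneg tz) hτ
  exact h₁.layeredGroundEnergy_lt_meanEnergy_mix_of_cap_lt_floors_of_cost_le t t' hU
    (w := fun _ : Fin 1 => (unitVec (0 : Fin 3) : Site 3)) (fun _ => unitVec_zero_apply_zero_ne_zero) (fun _ => tz) le_rfl
    (fun _ => unitVec_mem_thicken_one 0) h₂ hρ₁0 hρ₂2 hn₁ hn12 hn₂ ha hb hab hcap hf₁ hf₂ hk hM₀ hl0 hl1

/-! ### §2 `T > 0`: canonical equilibrium states of the layered crystal, hot-anchored energy-window form -/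

section LayeredThermal

variable (t t' : ℝ) {U : ℝ} (hU : 0 ≤ U) {β : ℝ} (hβ : 0 < β) {κ : Type*} [Fintype κ] {w : κ → Site 3} (hw : ∀ b, w b 0 ≠ 0)
  (tz : κ → ℝ) {R' : ℝ} (hR' : 1 ≤ R') (hwR' : ∀ b, w b ∈ thicken ({0} : Finset (Site 3)) R') {ω₁ ω₂ : InfVolFermionState 3}
include hU hβ hw hR' hwR'

/-- **`T > 0` competing-orders word of the LAYERED crystal, hot-anchored energy-window form.** `U ≥ 0`, `β > 0`; translation-invariant
`ω₁, ω₂` on `ℤ³` with `0 < ρ(ω₁) ≤ n₁ < n₂ ≤ ρ(ω₂) < 2`; weights `a, b ≥ 0`, `a + b = 1`; 2D inputs: a ground-state energy CAP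
`e(an₁ + bn₂) ≤ c`, FLOORS `f_i ≤ e(n_i)`, pressure ceilings `p(β_{h,i}; n_i) ≤ π_i` at hotter `0 ≤ β_{h,i} ≤ β`; and
`aπ₁ + bπ₂ + β_{h,1}(af₁) + β_{h,2}(bf₂) < β·(af₁ + bf₂ − c − (4/π)Σ_b|tz_b|)`. Then for every `0 < λ < 1` the mixture is NOT a canonical
equilibrium state of the layered crystal at `β`: `s̄(mix) − β e_{Φ₃}(mix) < P₃(β; ρ(mix))`. (Floor at the mean density `P₃ ≥ p ≥ −βe ≥ −βc`;
caps at the outer densities `P₃(n_i) ≤ p(β;n_i) + βκ ≤ π_i − (β − β_{h,i})f_i + βκ`.) [cite: Israel1979, Thm. I.2.4]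
[cite: BratteliKishimotoRobinson1978, Thm. 2 (condition 2)] -/
theorem IsTranslationInvariant.sub_mul_layered_lt_varPressureAt_mix_of_hotAnchors_of_le (h₁ : ω₁.IsTranslationInvariant)
    (h₂ : ω₂.IsTranslationInvariant) (hρ₁0 : 0 < ω₁.density) (hρ₂2 : ω₂.density < 2)
    {n₁ n₂ : ℝ} (hn₁ : ω₁.density ≤ n₁) (hn12 : n₁ < n₂) (hn₂ : n₂ ≤ ω₂.density)
    {a b : ℝ} (ha : 0 ≤ a) (hb : 0 ≤ b) (hab : a + b = 1) {c f₁ f₂ : ℝ}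
    (hcap : energyDensityTT' t t' U (a * n₁ + b * n₂) ≤ c)
    (hf₁ : f₁ ≤ energyDensityTT' t t' U n₁) (hf₂ : f₂ ≤ energyDensityTT' t t' U n₂)
    {βh₁ βh₂ π₁ π₂ : ℝ} (hβh₁ : 0 ≤ βh₁) (hβh₂ : 0 ≤ βh₂) (hle₁ : βh₁ ≤ β) (hle₂ : βh₂ ≤ β)
    (hπ₁ : pressureTT' βh₁ t t' U n₁ ≤ π₁) (hπ₂ : pressureTT' βh₂ t t' U n₂ ≤ π₂)
    (hM : a * π₁ + b * π₂ + βh₁ * (a * f₁) + βh₂ * (b * f₂) <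
      β * (a * f₁ + b * f₂ - c - 4 / Real.pi * ∑ b, |tz b|))
    {lam : ℝ} (hl0 : 0 < lam) (hl1 : lam < 1) :
    (InfVolFermionState.mix lam hl0.le hl1.le ω₁ ω₂).entropyDensitySup -
        β * (InfVolFermionState.mix lam hl0.le hl1.le ω₁ ω₂).meanEnergy (layeredHubbardTTPrime t t' U w tz) R' <
      (layeredHubbardTTPrime t t' U w tz).varPressureAt β R' (InfVolFermionState.mix lam hl0.le hl1.le ω₁ ω₂).density := by
  have hn₁0 : 0 < n₁ := lt_of_lt_of_le hρ₁0 hn₁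
  have hn₁2 : n₁ < 2 := by linarith
  have hn₂0 : 0 < n₂ := by linarith
  have hn₂2 : n₂ < 2 := lt_of_le_of_lt hn₂ hρ₂2
  obtain ⟨hmlo, hmhi⟩ := convexComb_mem_Icc' ha hb hab hn12.le
  have hm0 : 0 < a * n₁ + b * n₂ := lt_of_lt_of_le hn₁0 hmlo
  have hm2 : a * n₁ + b * n₂ < 2 := lt_of_le_of_lt hmhi hn₂2
  set K : ℝ := 4 / Real.pi * ∑ b, |tz b| with hK
  -- floor at the mean density
  have hW : -(β * c) ≤ (layeredHubbardTTPrime t t' U w tz).varPressureAt β R' (a * n₁ + b * n₂) := by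
    have h1 := (varPressureAt_layeredHubbardTTPrime_mem_Icc_pressureTT' hβ t t' hU hw tz hR' hwR' hm0 hm2).1
    have h2 := (pressureTT'_mem_Icc hβ.le t t' hU hm0.le hm2).1
    nlinarith [mul_le_mul_of_nonneg_left hcap hβ.le]
  -- caps at the outer densities
  have hQ₁ : (layeredHubbardTTPrime t t' U w tz).varPressureAt β R' n₁ ≤ π₁ - (β - βh₁) * f₁ + β * K := by
    have h1 := (varPressureAt_layeredHubbardTTPrime_mem_Icc_pressureTT' hβ t t' hU hw tz hR' hwR' hn₁0 hn₁2).2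
    have h2 := pressureTT'_le_hotCeiling_sub_mul_of_floor t t' hU hn₁0.le hn₁2 hβh₁ hle₁ hπ₁ hf₁
    rw [hK]; linarith
  have hQ₂ : (layeredHubbardTTPrime t t' U w tz).varPressureAt β R' n₂ ≤ π₂ - (β - βh₂) * f₂ + β * K := by
    have h1 := (varPressureAt_layeredHubbardTTPrime_mem_Icc_pressureTT' hβ t t' hU hw tz hR' hwR' hn₂0 hn₂2).2
    have h2 := pressureTT'_le_hotCeiling_sub_mul_of_floor t t' hU hn₂0.le hn₂2 hβh₂ hle₂ hπ₂ hf₂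
    rw [hK]; linarith
  refine h₁.sub_mul_lt_varPressureAt_mix_of_caps_lt_floor_of_le (by norm_num : (0 : ℕ) < 3) β (layeredHubbardTTPrime t t' U w tz) R'
    h₂ hn₁ hn12 hn₂ ha hb hab hW hQ₁ hQ₂ ?_ hl0 hl1
  have e : a * (π₁ - (β - βh₁) * f₁ + β * K) + b * (π₂ - (β - βh₂) * f₂ + β * K) =
      a * π₁ + b * π₂ + βh₁ * (a * f₁) + βh₂ * (b * f₂) - β * (a * f₁ + b * f₂) + (a + b) * (β * K) := by ring
  rw [e, hab, one_mul]
  have e2 : β * (a * f₁ + b * f₂ - c - K) = β * (a * f₁ + b * f₂) - β * c - β * K := by ring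
  rw [e2] at hM
  linarith

/-- **Threshold / cost form** (how instances print «for every `β ≥ β₀` and every stacking with `(4/π)Σ|tz| ≤ k`»): with
`M₀ := af₁ + bf₂ − c − k ≥ 0`, `aπ₁ + bπ₂ + β_{h,1}af₁ + β_{h,2}bf₂ < β₀·M₀`, `β_{h,i} ≤ β₀ ≤ β` and `(4/π)Σ_b|tz_b| ≤ k`: the coexistence is excluded
among canonical equilibrium states of the layered crystal at `β`. [cite: Israel1979, Thm. I.2.4] [cite: BratteliKishimotoRobinson1978, Thm. 2 (condition 2)] -/
theorem IsTranslationInvariant.sub_mul_layered_lt_varPressureAt_mix_of_hotAnchors_of_threshold_of_cost_le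
    (h₁ : ω₁.IsTranslationInvariant) (h₂ : ω₂.IsTranslationInvariant) (hρ₁0 : 0 < ω₁.density) (hρ₂2 : ω₂.density < 2)
    {n₁ n₂ : ℝ} (hn₁ : ω₁.density ≤ n₁) (hn12 : n₁ < n₂) (hn₂ : n₂ ≤ ω₂.density)
    {a b : ℝ} (ha : 0 ≤ a) (hb : 0 ≤ b) (hab : a + b = 1) {c f₁ f₂ : ℝ}
    (hcap : energyDensityTT' t t' U (a * n₁ + b * n₂) ≤ c)
    (hf₁ : f₁ ≤ energyDensityTT' t t' U n₁) (hf₂ : f₂ ≤ energyDensityTT' t t' U n₂)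
    {βh₁ βh₂ π₁ π₂ β₀ k : ℝ} (hβh₁ : 0 ≤ βh₁) (hβh₂ : 0 ≤ βh₂) (h0₁ : βh₁ ≤ β₀) (h0₂ : βh₂ ≤ β₀) (hβ₀ : β₀ ≤ β)
    (hπ₁ : pressureTT' βh₁ t t' U n₁ ≤ π₁) (hπ₂ : pressureTT' βh₂ t t' U n₂ ≤ π₂)
    (hk : 4 / Real.pi * ∑ b, |tz b| ≤ k)
    (hMnn : 0 ≤ a * f₁ + b * f₂ - c - k)
    (hM₀ : a * π₁ + b * π₂ + βh₁ * (a * f₁) + βh₂ * (b * f₂) < β₀ * (a * f₁ + b * f₂ - c - k))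
    {lam : ℝ} (hl0 : 0 < lam) (hl1 : lam < 1) :
    (InfVolFermionState.mix lam hl0.le hl1.le ω₁ ω₂).entropyDensitySup -
        β * (InfVolFermionState.mix lam hl0.le hl1.le ω₁ ω₂).meanEnergy (layeredHubbardTTPrime t t' U w tz) R' <
      (layeredHubbardTTPrime t t' U w tz).varPressureAt β R' (InfVolFermionState.mix lam hl0.le hl1.le ω₁ ω₂).density := by
  refine h₁.sub_mul_layered_lt_varPressureAt_mix_of_hotAnchors_of_le t t' hU hβ hw tz hR' hwR' h₂ hρ₁0 hρ₂2 hn₁ hn12 hn₂ ha hb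
    hab hcap hf₁ hf₂ hβh₁ hβh₂ (h0₁.trans hβ₀) (h0₂.trans hβ₀) hπ₁ hπ₂ ?_ hl0 hl1
  have k1 : β₀ * (a * f₁ + b * f₂ - c - k) ≤ β * (a * f₁ + b * f₂ - c - k) := mul_le_mul_of_nonneg_right hβ₀ hMnn
  have k2 : β * (a * f₁ + b * f₂ - c - k) ≤ β * (a * f₁ + b * f₂ - c - 4 / Real.pi * ∑ b, |tz b|) :=
    mul_le_mul_of_nonneg_left (by linarith) hβ.le
  linarith

end LayeredThermal

/-- **Simple tetragonal stacking, `T > 0`, threshold form**: one vertical hopping with `|t_z| ≤ τ₀`; `M₀ := af₁ + bf₂ − c − (200/157)τ₀ ≥ 0`,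
`aπ₁ + bπ₂ + β_{h,1}af₁ + β_{h,2}bf₂ < β₀·M₀`, `β_{h,i} ≤ β₀ ≤ β`: the coexistence is excluded among canonical equilibrium states of
`verticalHubbardTTPrime t t' U t_z` at `β`. [cite: Israel1979, Thm. I.2.4] [cite: PavariniEtAl2001, eq. (1)] -/
theorem IsTranslationInvariant.sub_mul_vertical_lt_varPressureAt_mix_of_hotAnchors_of_threshold_of_abs_le (t t' : ℝ) {U : ℝ}
    (hU : 0 ≤ U) {β : ℝ} (hβ : 0 < β) {tz τ₀ : ℝ} (hτ : |tz| ≤ τ₀) {ω₁ ω₂ : InfVolFermionState 3}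
    (h₁ : ω₁.IsTranslationInvariant) (h₂ : ω₂.IsTranslationInvariant) (hρ₁0 : 0 < ω₁.density) (hρ₂2 : ω₂.density < 2)
    {n₁ n₂ : ℝ} (hn₁ : ω₁.density ≤ n₁) (hn12 : n₁ < n₂) (hn₂ : n₂ ≤ ω₂.density)
    {a b : ℝ} (ha : 0 ≤ a) (hb : 0 ≤ b) (hab : a + b = 1) {c f₁ f₂ : ℝ}
    (hcap : energyDensityTT' t t' U (a * n₁ + b * n₂) ≤ c)
    (hf₁ : f₁ ≤ energyDensityTT' t t' U n₁) (hf₂ : f₂ ≤ energyDensityTT' t t' U n₂)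
    {βh₁ βh₂ π₁ π₂ β₀ : ℝ} (hβh₁ : 0 ≤ βh₁) (hβh₂ : 0 ≤ βh₂) (h0₁ : βh₁ ≤ β₀) (h0₂ : βh₂ ≤ β₀) (hβ₀ : β₀ ≤ β)
    (hπ₁ : pressureTT' βh₁ t t' U n₁ ≤ π₁) (hπ₂ : pressureTT' βh₂ t t' U n₂ ≤ π₂)
    (hMnn : 0 ≤ a * f₁ + b * f₂ - c - 200 / 157 * τ₀)
    (hM₀ : a * π₁ + b * π₂ + βh₁ * (a * f₁) + βh₂ * (b * f₂) < β₀ * (a * f₁ + b * f₂ - c - 200 / 157 * τ₀))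
    {lam : ℝ} (hl0 : 0 < lam) (hl1 : lam < 1) :
    (InfVolFermionState.mix lam hl0.le hl1.le ω₁ ω₂).entropyDensitySup -
        β * (InfVolFermionState.mix lam hl0.le hl1.le ω₁ ω₂).meanEnergy (verticalHubbardTTPrime t t' U tz) 1 <
      (verticalHubbardTTPrime t t' U tz).varPressureAt β 1 (InfVolFermionState.mix lam hl0.le hl1.le ω₁ ω₂).density := by
  have hk : 4 / Real.pi * ∑ _b : Fin 1, |(fun _ : Fin 1 => tz) _b| ≤ 200 / 157 * τ₀ := by
    simp only [Finset.univ_unique, Fin.default_eq_zero, Finset.sum_singleton]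
    exact four_div_pi_mul_le_of_le (abs_nonneg tz) hτ
  exact h₁.sub_mul_layered_lt_varPressureAt_mix_of_hotAnchors_of_threshold_of_cost_le t t' hU hβ
    (w := fun _ : Fin 1 => (unitVec (0 : Fin 3) : Site 3)) (fun _ => unitVec_zero_apply_zero_ne_zero) (fun _ => tz) le_rfl
    (fun _ => unitVec_mem_thicken_one 0) h₂ hρ₁0 hρ₂2 hn₁ hn12 hn₂ ha hb hab hcap hf₁ hf₂ hβh₁ hβh₂ h0₁ h0₂ hβ₀ hπ₁ hπ₂ hk hMnn
    hM₀ hl0 hl1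

/-! ### §3 `t_z = 0`: decoupled layers -/

/-- **Decoupled layers**: at `t_z = 0` the canonical variational pressure of the layered crystal IS the 2D canonical pressure, so a 3D state
whose free-energy functional is strictly below `pressureTT' β t t' U ρ(ω)` is not a canonical equilibrium state of the decoupled stack
(`0 < ρ(ω) < 2`). [cite: ArakiMoriya2003, §11.1 Theorem 11.2] -/
theorem sub_mul_lt_varPressureAt_layered_zero_of_lt_pressureTT' (t t' : ℝ) {U : ℝ} (hU : 0 ≤ U) {β : ℝ} (hβ : 0 < β)
    {κ : Type*} [Fintype κ] {w : κ → Site 3} (hw : ∀ b, w b 0 ≠ 0) {R' : ℝ} (hR' : 1 ≤ R')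
    (hwR' : ∀ b, w b ∈ thicken ({0} : Finset (Site 3)) R') {ω : InfVolFermionState 3} (hρ0 : 0 < ω.density) (hρ2 : ω.density < 2)
    (hlt : ω.entropyDensitySup - β * ω.meanEnergy (layeredHubbardTTPrime t t' U w fun _ => 0) R' < pressureTT' β t t' U ω.density) :
    ω.entropyDensitySup - β * ω.meanEnergy (layeredHubbardTTPrime t t' U w fun _ => 0) R' <
      (layeredHubbardTTPrime t t' U w fun _ => 0).varPressureAt β R' ω.density := by
  rwa [varPressureAt_layeredHubbardTTPrime_zero hβ t t' hU hw hR' hwR' hρ0 hρ2]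

end InfVolFermionState

end Literature.MathematicalPhysics.QuantumLattice

end
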